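import Summits.BirchSwinnertonDyer.BirchSwinnertonDyer.Theorems.ManinLocalTwoThreeBasisSolveFortyFour
import Literature.NumberTheory.EllipticCurves.CongruenceNumber
import Literature.NumberTheory.EllipticCurves.CuspFormLFunctionFrickeProofs
import HarnessLib

/-!
# Level 44 (C2 domain, genus 4), part 4b: THE NEWFORM OF EVERY `X₀(44)`-DATUM IS `Φ₄₄`, FACT-FREE

Cell `bsd-f2-manin`, route `ManinLocalTwoThree`, crux C2 `ManinOddAtFour` (stmt-BirchSwinnertonDyer-22967), LEAD p1 gen 24;
`--supports stmt-BirchSwinnertonDyer-22967` (helper).  The hypotheses of part 2 (`…NewformPinningFortyFourOfTable`) DISCHARGED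
from the nine-form basis of `M₂(Γ₀(44))` (part 4a `…BasisFortyFour`): the eight column relations hold on all of `M₂(Γ₀(44))`
(`columnRelations_fortyFour`), the pivot coefficients `0,1,2,3,4,5,6,8,11` separate `M₂(Γ₀(44))` (`pivotsSeparate_fortyFour`),
and the two old witnesses exist (`oldWitness₁/₂_fortyFour`).  Hence, for every elliptic `W/ℚ` and every
`D : ModularParametrizationData W 44`:

* **`coeffs_eq_fortyFourA_holds D`**: `a₂ = a₄ = a₆ = a₈ = 0`, `a₃ = 1`, `a₅ = −3`, `a₁₁ = −1`;
* **`f_apply_eq_phi44 D : ⇑D.f = ⇑Φ₄₄`** with the explicit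
  `Φ₄₄ = −(6/5)O₁ − (6/5)O₂ − (3/5)O₄ + (4/5)B1 + 3B2 − (4/5)B4 ∈ M₂(Γ₀(44))`
  (an g51: `= 44a1` through `q⁶⁰`) — no newness, eigenform or cuspidality statement about `Φ₄₄` is ever proved; it
  inherits all three from `D.f` (MEMO-an §96 «pinning by the curve's own recursion», M₂-variant).

HONEST FRAMING: unconditional; the remaining half of «`|c| = 1` ∧ `2 ∤ c` on `X₀(44)`» is the Néron squeeze for `44a1`
(an §95.7: `x₄₄ = 4/3 + η₂²η₂₂²/(η₄²η₄₄²)`, `y₄₄`, cusp unit `h₄₄ = η₄⁴η₂₂²/(η₂²η₄₄⁴)`).  Nothing here proves C2, Manin's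
conjecture or BSD.
[cite: DiamondShurman2005, Thm. 3.5.1, §5.7, §8.8] [cite: AtkinLehner1970, Thm. 5] [cite: CremonaAlgorithms1997, Table 3 (N = 11, 44)]
-/

set_option autoImplicit false
-- lint-debt: the directory name repeats the summit name (sibling precedent `ManinLocalTwoThreeNewformFortyEight.lean`)
set_option linter.dupNamespace false

noncomputable section

open Complex Polynomial
open UpperHalfPlane hiding I
open scoped MatrixGroups ModularForm
open CongruenceSubgroup
open Literature.NumberTheory.ModularForms
open Literature.NumberTheory.EllipticCurves Literature.NumberTheory.EllipticCurves.ModularForms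

namespace Summit.BirchSwinnertonDyer.BirchSwinnertonDyer.Theorems.ManinLocalTwoThree.LevelFortyFour

/-! ## §1 The hypotheses of part 2, discharged -/

/-- **The eight column relations hold on all of `M₂(Γ₀(44))`.** [cite: DiamondShurman2005, Thm. 3.5.1] -/
theorem columnRelations_fortyFour (F : ModularForm (Gamma0 44) 2) :
    (qExpansion 1 ⇑F).coeff 7 = 2 * (qExpansion 1 ⇑F).coeff 3 ∧
      (qExpansion 1 ⇑F).coeff 9 = -(qExpansion 1 ⇑F).coeff 1 + 2 * (qExpansion 1 ⇑F).coeff 3 + (qExpansion 1 ⇑F).coeff 5 ∧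
      (qExpansion 1 ⇑F).coeff 10 = 2 * (qExpansion 1 ⇑F).coeff 2 + (qExpansion 1 ⇑F).coeff 6 ∧
      (qExpansion 1 ⇑F).coeff 12 = 2 * (qExpansion 1 ⇑F).coeff 2 + (qExpansion 1 ⇑F).coeff 4 + (qExpansion 1 ⇑F).coeff 8 ∧
      (qExpansion 1 ⇑F).coeff 15 = 3 * (qExpansion 1 ⇑F).coeff 3 + 2 * (qExpansion 1 ⇑F).coeff 5 ∧
      (qExpansion 1 ⇑F).coeff 16 = 4 * (qExpansion 1 ⇑F).coeff 2 + 4 * (qExpansion 1 ⇑F).coeff 4 -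
        2 * (qExpansion 1 ⇑F).coeff 6 + (qExpansion 1 ⇑F).coeff 8 ∧
      (qExpansion 1 ⇑F).coeff 19 = 4 * (qExpansion 1 ⇑F).coeff 1 + 4 * (qExpansion 1 ⇑F).coeff 3 ∧
      (qExpansion 1 ⇑F).coeff 33 = -2 * (qExpansion 1 ⇑F).coeff 1 + 2 * (qExpansion 1 ⇑F).coeff 3 -
        (qExpansion 1 ⇑F).coeff 5 + 4 * (qExpansion 1 ⇑F).coeff 11 := by
  obtain ⟨c, rfl⟩ := exists_coords_fortyFour F
  rw [coeff_comb_7, coeff_comb_3, coeff_comb_9, coeff_comb_1, coeff_comb_5, coeff_comb_10, coeff_comb_2, coeff_comb_6, coeff_comb_12,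
    coeff_comb_4, coeff_comb_8, coeff_comb_15, coeff_comb_16, coeff_comb_19, coeff_comb_33, coeff_comb_11]
  refine ⟨by ring, by ring, by ring, by ring, by ring, by ring, by ring, by ring⟩

/-- **The pivot coefficients `0,1,2,3,4,5,6,8,11` separate `M₂(Γ₀(44))`.** [cite: DiamondShurman2005, Thm. 3.5.1] -/
theorem pivotsSeparate_fortyFour (F G : ModularForm (Gamma0 44) 2)
    (e0 : (qExpansion 1 ⇑F).coeff 0 = (qExpansion 1 ⇑G).coeff 0) (e1 : (qExpansion 1 ⇑F).coeff 1 = (qExpansion 1 ⇑G).coeff 1)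
    (e2 : (qExpansion 1 ⇑F).coeff 2 = (qExpansion 1 ⇑G).coeff 2) (e3 : (qExpansion 1 ⇑F).coeff 3 = (qExpansion 1 ⇑G).coeff 3)
    (e4 : (qExpansion 1 ⇑F).coeff 4 = (qExpansion 1 ⇑G).coeff 4) (e5 : (qExpansion 1 ⇑F).coeff 5 = (qExpansion 1 ⇑G).coeff 5)
    (e6 : (qExpansion 1 ⇑F).coeff 6 = (qExpansion 1 ⇑G).coeff 6) (e8 : (qExpansion 1 ⇑F).coeff 8 = (qExpansion 1 ⇑G).coeff 8)
    (e11 : (qExpansion 1 ⇑F).coeff 11 = (qExpansion 1 ⇑G).coeff 11) : (F : ℍ → ℂ) = G := by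
  obtain ⟨c, rfl⟩ := exists_coords_fortyFour F
  obtain ⟨d, rfl⟩ := exists_coords_fortyFour G
  rw [coeff_comb_0 c, coeff_comb_0 d] at e0
  rw [coeff_comb_1 c, coeff_comb_1 d] at e1
  rw [coeff_comb_2 c, coeff_comb_2 d] at e2
  rw [coeff_comb_3 c, coeff_comb_3 d] at e3
  rw [coeff_comb_4 c, coeff_comb_4 d] at e4
  rw [coeff_comb_5 c, coeff_comb_5 d] at e5
  rw [coeff_comb_6 c, coeff_comb_6 d] at e6
  rw [coeff_comb_8 c, coeff_comb_8 d] at e8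
  rw [coeff_comb_11 c, coeff_comb_11 d] at e11
  have hz := coords_eq_zero_of_pivots (c - d)
    (by simp only [Pi.sub_apply]; linear_combination e0)
    (by simp only [Pi.sub_apply]; linear_combination e1)
    (by simp only [Pi.sub_apply]; linear_combination e2)
    (by simp only [Pi.sub_apply]; linear_combination e3)
    (by simp only [Pi.sub_apply]; linear_combination e4)
    (by simp only [Pi.sub_apply]; linear_combination e5)
    (by simp only [Pi.sub_apply]; linear_combination e6)
    (by simp only [Pi.sub_apply]; linear_combination e8)
    (by simp only [Pi.sub_apply]; linear_combination e11)
  have hcd : c = d := funext fun i ↦ sub_eq_zero.mp (hz i)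
  rw [hcd]

/-- **Old witness 1**: `ι₁ φ₁₁ ∈ S₂(Γ₀(44))^{old}` has the pivot vector of `11a1`. [cite: CremonaAlgorithms1997, Table 3 (N = 11)] -/
theorem oldWitness₁_fortyFour : ∃ G : CuspForm (Gamma0 44) 2, G ∈ oldSubspace0 44 2 ∧ cuspCoeff G 1 = 1 ∧ cuspCoeff G 2 = -2 ∧
    cuspCoeff G 3 = -1 ∧ cuspCoeff G 4 = 2 ∧ cuspCoeff G 5 = 1 ∧ cuspCoeff G 6 = 2 ∧ cuspCoeff G 8 = 0 ∧
    cuspCoeff G 11 = 1 := by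
  refine ⟨degeneracyMap0 11 44 1 2 cuspFormEtaProductEleven, iota_phi11_mem_old 1 (Or.inl rfl), ?_, ?_, ?_, ?_, ?_, ?_, ?_, ?_⟩ <;>
    (rw [cuspCoeff_iota1_phi11 _ (by norm_num)]; norm_num)

/-- **Old witness 2**: `ι₁ φ₁₁ + ι₂ φ₁₁ + ½ ι₄ φ₁₁ ∈ S₂(Γ₀(44))^{old}` (the `2`-depletion `Σ_{2 ∤ n} aₙ(11a1) qⁿ`) has the
pivot vector `(1, 0, −1, 0, 1, 0, 0, 1)`. [cite: CremonaAlgorithms1997, Table 3 (N = 11)] -/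
theorem oldWitness₂_fortyFour : ∃ G : CuspForm (Gamma0 44) 2, G ∈ oldSubspace0 44 2 ∧ cuspCoeff G 1 = 1 ∧ cuspCoeff G 2 = 0 ∧
    cuspCoeff G 3 = -1 ∧ cuspCoeff G 4 = 0 ∧ cuspCoeff G 5 = 1 ∧ cuspCoeff G 6 = 0 ∧ cuspCoeff G 8 = 0 ∧
    cuspCoeff G 11 = 1 := by
  refine ⟨degeneracyMap0 11 44 1 2 cuspFormEtaProductEleven + degeneracyMap0 11 44 2 2 cuspFormEtaProductEleven +
    (1 / 2 : ℂ) • degeneracyMap0 11 44 4 2 cuspFormEtaProductEleven, ?_, ?_, ?_, ?_, ?_, ?_, ?_, ?_, ?_⟩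
  · exact Submodule.add_mem _ (Submodule.add_mem _ (iota_phi11_mem_old 1 (Or.inl rfl))
      (iota_phi11_mem_old 2 (Or.inr (Or.inl rfl)))) (Submodule.smul_mem _ _ (iota_phi11_mem_old 4 (Or.inr (Or.inr rfl))))
  all_goals
    rw [cuspCoeff_add_form (one_mem_strictPeriods_coe_gamma0 44), cuspCoeff_add_form (one_mem_strictPeriods_coe_gamma0 44),
      cuspCoeff_smul, cuspCoeff_iota1_phi11 _ (by norm_num), cuspCoeff_iota2_phi11 _ (by norm_num),
      cuspCoeff_iota4_phi11 _ (by norm_num)]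
    norm_num

/-! ## §2 The pinning, unconditional -/

variable {W : WeierstrassCurve ℚ} [W.IsElliptic]

/-- **`(a₂, a₃, a₄, a₅, a₆, a₈, a₁₁)(W) = (0, 1, 0, −3, 0, 0, −1)` for every elliptic `W/ℚ` carrying an `X₀(44)`-datum** — FACT-FREE.
[cite: CremonaAlgorithms1997, Table 3 (N = 44)] -/
theorem coeffs_eq_fortyFourA_holds (D : ModularParametrizationData W 44) :
    W.LFunction 2 = 0 ∧ W.LFunction 3 = 1 ∧ W.LFunction 4 = 0 ∧ W.LFunction 5 = -3 ∧ W.LFunction 6 = 0 ∧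
      W.LFunction 8 = 0 ∧ W.LFunction 11 = -1 :=
  coeffs_eq_fortyFourA columnRelations_fortyFour pivotsSeparate_fortyFour oldWitness₁_fortyFour oldWitness₂_fortyFour D

/-- The coordinates of `Φ₄₄` on the nine forms. [cite: CremonaAlgorithms1997, Table 3 (N = 44)] -/
def phi44Coords : Fin 9 → ℂ := ![(-6 : ℂ) / 5, (-6 : ℂ) / 5, (-3 : ℂ) / 5, (4 : ℂ) / 5, 3, 0, (-4 : ℂ) / 5, 0, 0]

/-- **The explicit newform** `Φ₄₄ = −(6/5)O₁ − (6/5)O₂ − (3/5)O₄ + (4/5)B1 + 3B2 − (4/5)B4 ∈ M₂(Γ₀(44))`.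
[cite: CremonaAlgorithms1997, Table 3 (N = 44)] -/
def Phi44 : ModularForm (Gamma0 44) 2 := ∑ i, phi44Coords i • basisForms i

/-- The coordinate values. [folklore] -/
theorem phi44Coords_values : phi44Coords 0 = (-6 : ℂ) / 5 ∧ phi44Coords 1 = (-6 : ℂ) / 5 ∧ phi44Coords 2 = (-3 : ℂ) / 5 ∧
    phi44Coords 3 = (4 : ℂ) / 5 ∧ phi44Coords 4 = 3 ∧ phi44Coords 5 = 0 ∧ phi44Coords 6 = (-4 : ℂ) / 5 ∧
    phi44Coords 7 = 0 ∧ phi44Coords 8 = 0 := by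
  unfold phi44Coords
  refine ⟨rfl, rfl, rfl, rfl, rfl, rfl, rfl, rfl, rfl⟩

/-- **THE NEWFORM OF EVERY `X₀(44)`-DATUM IS `Φ₄₄`**: `⇑D.f = ⇑Φ₄₄` — FACT-FREE. [cite: CremonaAlgorithms1997, Table 3 (N = 44)] -/
theorem f_apply_eq_phi44 (D : ModularParametrizationData W 44) : (⇑D.f : ℍ → ℂ) = ⇑Phi44 := by
  obtain ⟨v0, v1, v2, v3, v4, v5, v6, v7, v8⟩ := phi44Coords_values
  refine coe_f_eq_of_pivots columnRelations_fortyFour pivotsSeparate_fortyFour oldWitness₁_fortyFour oldWitness₂_fortyFour D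
    Phi44 ?_ ?_ ?_ ?_ ?_ ?_ ?_ ?_ ?_
  · rw [Phi44, coeff_comb_0, v7]; norm_num
  · rw [Phi44, coeff_comb_1, v0, v4, v6]; norm_num
  · rw [Phi44, coeff_comb_2, v0, v1]; norm_num
  · rw [Phi44, coeff_comb_3, v0, v4, v6]; norm_num
  · rw [Phi44, coeff_comb_4, v0, v1, v2]; norm_num
  · rw [Phi44, coeff_comb_5, v0, v4, v6, v8]; norm_num
  · rw [Phi44, coeff_comb_6, v0, v1, v5, v8]; norm_num
  · rw [Phi44, coeff_comb_8, v1, v2, v5, v8]; norm_num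
  · rw [Phi44, coeff_comb_11, v0, v3, v4, v6, v7, v8]; norm_num

end Summit.BirchSwinnertonDyer.BirchSwinnertonDyer.Theorems.ManinLocalTwoThree.LevelFortyFour

end
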